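import Summits.ValiantsHypothesis.ValiantsHypothesis.Theorems.GrenetZeonDualUnipotentThreeHalvesLongMassSubmodule

/-!
# `GrenetZeon.DualUnipotentThreeHalves` (stmt-ValiantsHypothesis-24318), line `slow_core`, stub (c) `SlowCore.LongMassSlowLawInv`:
# THE TWO UNIVERSAL CEILINGS of the intrinsic (c)-price — FREEZE (`W = ⊥`) and ABSORB (`W = V`) (submodule currency)

Companion of ✓ `longMassSlowLawInv_iff_submodule` (`…LongMassSubmodule`), ✓ `…LongMassSubmoduleRules`, ✓ `…LongMassCommutingSum`.  The pencil
ceilings U1/U2 of crit-7 V34 §1 (✓ `…LongMassCeilings`: `relCert_freeze`, `relCert_absorb_of_pow_eq_zero`) in the coordinate-free currency: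

* ★ `window_bot` / `price_freeze_submodule` — (U1) `W = ⊥`, `k = 0`: price `dim V` for EVERY `V ≤ M_b(ℂ)` (along `w = 0` the line is constant).
* ★ `window_top_of_pow_eq_zero` / `price_absorb_submodule` — (U2) `W = V`, `k = H − 1` whenever `A ^ H = 0` for all `A ∈ V` (`1 ≤ H`): price
  `n·(H − 1)` (the line `A + s·w` lies in `V ⊗ ℂ[s]`, so `(A + s w)^H = 0` as a polynomial identity — `MvPolynomial.funext` on the values
  `A + t·w ∈ V` — and lower powers have degree `≤ p ≤ H − 1`).

So in the live box of (c) (V34 §1) one needs simultaneously `dim V > c√n·b` and `H > c·b/√n + 1`.  Honest framing.  Bookkeeping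
(`--supports stmt-ValiantsHypothesis-24318`), NOT progress on (c): (c) `SlowCore.LongMassSlowLawInv`, S3, the crux 24318, 8062 and `VP ≠ VNP`
remain OPEN / NOT proved.  No sorry, no definitions, no named facts.
-/

-- single-conjunct layout: Sub = Summit, duplicated namespace component intended (the name is mandated)
set_option linter.dupNamespace false
set_option autoImplicit false

noncomputable section

namespace Summit.ValiantsHypothesis.ValiantsHypothesis.Theorems.GrenetZeon.LongMassHomogenise

open MvPolynomial Matrix
open scoped BigOperators

variable {b : ℕ}

/-! ## §1 FREEZE: `W = ⊥` -/

/-- Along `w = 0` the line is the constant matrix `A`, whose powers have entries of degree `0`. -/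
theorem window_bot (A w : Matrix (Fin b) (Fin b) ℂ) (hw : w ∈ (⊥ : Submodule ℂ (Matrix (Fin b) (Fin b) ℂ))) (p : ℕ) (i j : Fin b) :
    (((A.map (C : ℂ → MvPolynomial (Fin 1) ℂ) + (X 0 : MvPolynomial (Fin 1) ℂ) • w.map C) ^ p :
      Matrix (Fin b) (Fin b) (MvPolynomial (Fin 1) ℂ)) i j).totalDegree ≤ 0 := by
  rw [(Submodule.mem_bot ℂ).mp hw, Matrix.map_zero C (map_zero C), smul_zero, add_zero,
    ← Matrix.map_pow (M := A) (f := (C : ℂ →+* MvPolynomial (Fin 1) ℂ)), Matrix.map_apply]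
  exact (totalDegree_C _).le

/-- ★ **(U1) FREEZE CEILING** (submodule currency): every `V ≤ M_b(ℂ)` has a certificate of price `dim V` (`W = ⊥`, `k = 0`). -/
theorem price_freeze_submodule (V : Submodule ℂ (Matrix (Fin b) (Fin b) ℂ)) (n : ℕ) :
    ∃ (W : Submodule ℂ (Matrix (Fin b) (Fin b) ℂ)) (k : ℕ), W ≤ V ∧
      (∀ A ∈ V, ∀ w ∈ W, ∀ p : ℕ, p ≤ n - 1 → ∀ i j : Fin b,
        ((((A.map (C : ℂ → MvPolynomial (Fin 1) ℂ) + (X 0 : MvPolynomial (Fin 1) ℂ) • w.map C) ^ p :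
          Matrix (Fin b) (Fin b) (MvPolynomial (Fin 1) ℂ)) i j).totalDegree ≤ k)) ∧
      n * k + (Module.finrank ℂ V - Module.finrank ℂ W) ≤ Module.finrank ℂ V :=
  ⟨⊥, 0, bot_le, fun A _ w hw p _ i j => window_bot A w hw p i j, by simp⟩

/-! ## §2 ABSORB: `W = V` -/

/-- The line `A + s·w` of two members of a space all of whose members have vanishing `H`-th power has vanishing `H`-th power as a POLYNOMIAL
matrix (evaluate at every `s = t`: `A + t w ∈ V`). -/
theorem lineMat_pow_eq_zero (V : Submodule ℂ (Matrix (Fin b) (Fin b) ℂ)) {H : ℕ} (hV : ∀ A ∈ V, A ^ H = 0)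
    {A w : Matrix (Fin b) (Fin b) ℂ} (hA : A ∈ V) (hw : w ∈ V) :
    (A.map (C : ℂ → MvPolynomial (Fin 1) ℂ) + (X 0 : MvPolynomial (Fin 1) ℂ) • w.map C) ^ H = 0 := by
  set M := A.map (C : ℂ → MvPolynomial (Fin 1) ℂ) + (X 0 : MvPolynomial (Fin 1) ℂ) • w.map C with hM
  -- every evaluation of `M` is a member of `V`
  have heval : ∀ y : Fin 1 → ℂ, M.map (eval y) = A + y 0 • w := by
    intro y
    ext i j
    simp [hM, Matrix.map_apply, Matrix.add_apply, Matrix.smul_apply, eval_C, eval_X]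
  refine Matrix.ext fun i j => ?_
  apply MvPolynomial.funext
  intro y
  have hmem : A + y 0 • w ∈ V := V.add_mem hA (V.smul_mem _ hw)
  have hpow := hV _ hmem
  rw [← heval y, ← Matrix.map_pow] at hpow
  have := congr_fun (congr_fun hpow i) j
  rw [Matrix.map_apply, Matrix.zero_apply] at this
  rw [this, Matrix.zero_apply, map_zero]

/-- Entries of the line matrix have degree `≤ 1`, hence entries of its `p`-th power have degree `≤ p`. -/
theorem totalDegree_lineMat_pow_le (A w : Matrix (Fin b) (Fin b) ℂ) (p : ℕ) (i j : Fin b) :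
    (((A.map (C : ℂ → MvPolynomial (Fin 1) ℂ) + (X 0 : MvPolynomial (Fin 1) ℂ) • w.map C) ^ p :
      Matrix (Fin b) (Fin b) (MvPolynomial (Fin 1) ℂ)) i j).totalDegree ≤ p := by
  set M := A.map (C : ℂ → MvPolynomial (Fin 1) ℂ) + (X 0 : MvPolynomial (Fin 1) ℂ) • w.map C with hM
  have h1 : ∀ i j, (M i j).totalDegree ≤ 1 := by
    intro i j
    simp only [hM, Matrix.add_apply, Matrix.map_apply, Matrix.smul_apply, smul_eq_mul]
    refine (totalDegree_add _ _).trans (max_le ?_ ?_)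
    · rw [totalDegree_C]; exact Nat.zero_le _
    · exact (totalDegree_mul _ _).trans (by rw [totalDegree_X, totalDegree_C])
  induction p generalizing i j with
  | zero =>
    rw [pow_zero, Matrix.one_apply]
    split_ifs
    · rw [totalDegree_one]
    · rw [totalDegree_zero]
  | succ p ih =>
    rw [pow_succ, Matrix.mul_apply]
    refine (totalDegree_finsetSum _ _).trans (Finset.sup_le fun l _ => ?_)
    exact (totalDegree_mul _ _).trans (Nat.add_le_add (ih i l) (h1 l j))

/-- Along directions INSIDE a space of nil-index `≤ H` (`1 ≤ H`), every power of the line has entries of degree `≤ H − 1`. -/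
theorem window_top_of_pow_eq_zero (V : Submodule ℂ (Matrix (Fin b) (Fin b) ℂ)) {H : ℕ} (hH : 1 ≤ H) (hV : ∀ A ∈ V, A ^ H = 0)
    {A w : Matrix (Fin b) (Fin b) ℂ} (hA : A ∈ V) (hw : w ∈ V) (p : ℕ) (i j : Fin b) :
    (((A.map (C : ℂ → MvPolynomial (Fin 1) ℂ) + (X 0 : MvPolynomial (Fin 1) ℂ) • w.map C) ^ p :
      Matrix (Fin b) (Fin b) (MvPolynomial (Fin 1) ℂ)) i j).totalDegree ≤ H - 1 := by
  by_cases hp : p < H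
  · exact (totalDegree_lineMat_pow_le A w p i j).trans (by omega)
  · have hsplit : p = H + (p - H) := by omega
    rw [hsplit, pow_add, lineMat_pow_eq_zero V hV hA hw, Matrix.zero_mul, Matrix.zero_apply, totalDegree_zero]
    exact Nat.zero_le _

/-- ★ **(U2) ABSORB CEILING** (submodule currency): a space `V ≤ M_b(ℂ)` all of whose members satisfy `A ^ H = 0` (`1 ≤ H`) has a
certificate of price `n·(H − 1)` (`W = V`, `k = H − 1`). -/
theorem price_absorb_submodule (V : Submodule ℂ (Matrix (Fin b) (Fin b) ℂ)) {H : ℕ} (hH : 1 ≤ H) (hV : ∀ A ∈ V, A ^ H = 0) (n : ℕ) :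
    ∃ (W : Submodule ℂ (Matrix (Fin b) (Fin b) ℂ)) (k : ℕ), W ≤ V ∧
      (∀ A ∈ V, ∀ w ∈ W, ∀ p : ℕ, p ≤ n - 1 → ∀ i j : Fin b,
        ((((A.map (C : ℂ → MvPolynomial (Fin 1) ℂ) + (X 0 : MvPolynomial (Fin 1) ℂ) • w.map C) ^ p :
          Matrix (Fin b) (Fin b) (MvPolynomial (Fin 1) ℂ)) i j).totalDegree ≤ k)) ∧
      n * k + (Module.finrank ℂ V - Module.finrank ℂ W) ≤ n * (H - 1) :=
  ⟨V, H - 1, le_rfl, fun _ hA _ hw p _ i j => window_top_of_pow_eq_zero V hH hV hA hw p i j, by simp⟩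

end Summit.ValiantsHypothesis.ValiantsHypothesis.Theorems.GrenetZeon.LongMassHomogenise

end
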